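import Literature.Probability.RandomPlanarGeometry.RadoContinuity
import HarnessLib

/-!
# Weak continuity of a conformally covariant curve family along uniformly convergent univalent maps, along any filter

Topic `Literature/Probability/RandomPlanarGeometry`. Proof-only file (no definition, no named
fact): the filter form of `ChordalFamily.IsConformallyCovariant.isRadoContinuous`
(`RadoContinuity.lean`, sequences `n → ∞`), needed along `t → 0⁺` by the outer-squeeze passage
to the limit of Lawler–Schramm–Werner's restriction property for a conformally covariant scaling
limit (G. F. Lawler, O. Schramm, W. Werner, *On the scaling limit of planar self-avoiding walk*,
Proc. Sympos. Pure Math. **72** (2004), arXiv:math/0204277, §2 "conformal invariance" and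
§3.4.5 "restriction property"; the mode of convergence of the domains — univalent maps over a
fixed Jordan domain converging uniformly on the closed domain — is the conclusion of Radó's
theorem, T. Radó 1923; Ch. Pommerenke, *Boundary Behaviour of Conformal Maps* (1992), §2.3
Thm. 2.11).

* `ChordalFamily.IsConformallyCovariant.tendsto_integral_of_tendstoUniformlyOn` — if `P` is
  conformally covariant with finite laws carried by curves in the closed domain, `B` is a
  Dobrushin domain, `Φ, Φ_i : ℂ → ℂ` are continuous, complex differentiable and injective on `B`,
  `D'` is any Dobrushin domain with carrier `Φ(B)` and marks `Φ(B.pt 0), Φ(B.pt 1)`, and,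
  EVENTUALLY along a countably generated filter `l`, `E_i` are Dobrushin domains with carriers
  `Φ_i(B)` and marks `Φ_i(B.pt 0), Φ_i(B.pt 1)`, with `Φ_i → Φ` uniformly on `closure B` along
  `l`, then `∫ f d(P E_i) → ∫ f d(P D')` along `l` for every bounded continuous `f` — same proof
  as the sequential case: `P E_i = (Φ_i)_* P B`, `P D' = Φ_* P B`
  (`IsConformallyCovariant.eq_map_of_image`), `Φ_i ∘ γ → Φ ∘ γ` in curve space for `γ ⊆ cl B`
  (`CurveClass.tendsto_map_of_tendstoUniformlyOn`), dominated convergence along `l`.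
* `….tendsto_integral_of_tendstoUniformlyOn_of_isChordal` — the chordal case.
* `….tendsto_integral_of_discUniformizers` — the instance consumed by the outer-squeeze glue of
  the summit routes (`RadoSqueezeFamily`, line `birth` of stmt-CriticalPhenomena-0773): closed-DISC
  uniformizers `Φ_t` of `E t` (`t > 0`) and `Φ` of `D'`, conformal from the open unit disc with
  `∓1 ↦` the marked points, `Φ_t → Φ` uniformly on the closed unit disc as `t → 0⁺`, give
  `∫ f dP(E t) → ∫ f dP(D')` as `t → 0⁺`; the parameter domain is any Dobrushin structure on the
  unit disc marked at `-1, 1`, which exists (`DobrushinDomain.exists_carrier_eq_ball_pt_eq`: the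
  image of `DobrushinDomain.unitDisc`, marked at `1, -1`, under `z ↦ -z`).

Mathlib: `MeasureTheory.tendsto_integral_filter_of_dominated_convergence`, `integral_map`.
Tree: `IsConformallyCovariant.eq_map_of_image`, `CurveClass.tendsto_map_of_tendstoUniformlyOn`,
`CurveClass.continuous_map / measurable_map` (`RadoContinuity`, `ConformalRestrictionProofs`),
`MarkedDomain.map`, `similarity` (`ChordalCurveFamily`), `DobrushinDomain.unitDisc`
(`PlanarDomains`), `ConformalEquiv` (`ConformalMap`). Axioms `propext`, `Classical.choice`,
`Quot.sound`.
-/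

noncomputable section

open Set Filter MeasureTheory Topology
open scoped NNReal BoundedContinuousFunction Real

namespace Literature.Probability.RandomPlanarGeometry

namespace ChordalFamily

variable {P : ChordalFamily}

/-- **Weak continuity of a conformally covariant family along uniformly convergent univalent
maps, filter form.** For `P` conformally covariant with finite laws carried by curves in the
closed domain, a Dobrushin parameter domain `B`, `Φ` complex differentiable and injective on `B`
with image Dobrushin domain `D'` (carrier `Φ '' B`, marks `Φ (B.pt i)`), and, eventually along a
countably generated filter `l`, maps `Φ_i` complex differentiable and injective on `B` with image
Dobrushin domains `E i`, such that `Φ_i → Φ` uniformly on `closure B` along `l`: the laws converge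
weakly, `∫ f d(P (E i)) → ∫ f d(P D')`. (Radó's mode of convergence of Jordan domains; the
sequential case is `IsConformallyCovariant.isRadoContinuous`.) [folklore] -/
theorem IsConformallyCovariant.tendsto_integral_of_tendstoUniformlyOn
    (hcov : P.IsConformallyCovariant)
    (hfin : ∀ D : DobrushinDomain, IsFiniteMeasure (P D))
    (hcar : ∀ D : DobrushinDomain, ∀ᵐ γ ∂(P D), CurveClass.range γ ⊆ closure D.carrier)
    {ι : Type*} {l : Filter ι} [l.IsCountablyGenerated]
    {B D' : DobrushinDomain} {E : ι → DobrushinDomain} {Φ : C(ℂ, ℂ)} {Φs : ι → C(ℂ, ℂ)}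
    (hΦd : DifferentiableOn ℂ Φ B.carrier) (hΦi : InjOn Φ B.carrier)
    (hD' : D'.carrier = Φ '' B.carrier) (h0 : D'.pt 0 = Φ (B.pt 0)) (h1 : D'.pt 1 = Φ (B.pt 1))
    (hE : ∀ᶠ i in l, DifferentiableOn ℂ (Φs i) B.carrier ∧ InjOn (Φs i) B.carrier ∧
      (E i).carrier = Φs i '' B.carrier ∧ (E i).pt 0 = Φs i (B.pt 0) ∧
      (E i).pt 1 = Φs i (B.pt 1))
    (hunif : TendstoUniformlyOn (fun i => ⇑(Φs i)) Φ l (closure B.carrier))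
    (f : CurveClass ℂ →ᵇ ℝ) :
    Tendsto (fun i => ∫ γ, f γ ∂(P (E i))) l (𝓝 (∫ γ, f γ ∂(P D'))) := by
  haveI := hfin B
  have hD'eq : P D' = (P B).map (CurveClass.map Φ) := hcov.eq_map_of_image hΦd hΦi hD' h0 h1
  have hEeq : ∀ᶠ i in l, P (E i) = (P B).map (CurveClass.map (Φs i)) :=
    hE.mono fun i hi => hcov.eq_map_of_image hi.1 hi.2.1 hi.2.2.1 hi.2.2.2.1 hi.2.2.2.2
  have hint : ∀ Ψ : C(ℂ, ℂ),
      ∫ γ, f γ ∂((P B).map (CurveClass.map Ψ)) = ∫ γ, f (CurveClass.map Ψ γ) ∂(P B) := fun Ψ =>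
    integral_map (CurveClass.measurable_map Ψ).aemeasurable f.continuous.aestronglyMeasurable
  rw [hD'eq, hint]
  have hcongr : (fun i => ∫ γ, f (CurveClass.map (Φs i) γ) ∂(P B)) =ᶠ[l]
      fun i => ∫ γ, f γ ∂(P (E i)) :=
    hEeq.mono fun i hi => by
      show ∫ γ, f (CurveClass.map (Φs i) γ) ∂(P B) = ∫ γ, f γ ∂(P (E i))
      rw [hi, hint]
  refine Tendsto.congr' hcongr
    (tendsto_integral_filter_of_dominated_convergence (fun _ => ‖f‖) ?_ ?_ (integrable_const _) ?_)
  · exact Eventually.of_forall fun i =>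
      (f.continuous.comp (CurveClass.continuous_map _)).aestronglyMeasurable
  · exact Eventually.of_forall fun i => Eventually.of_forall fun γ => f.norm_coe_le_norm _
  · filter_upwards [hcar B] with γ hγ
    exact (f.continuous.tendsto _).comp (CurveClass.tendsto_map_of_tendstoUniformlyOn hunif γ hγ)

/-- The chordal case of `tendsto_integral_of_tendstoUniformlyOn` (all `P D` probability laws on
curves in `closure D`). [folklore] -/
theorem IsConformallyCovariant.tendsto_integral_of_tendstoUniformlyOn_of_isChordal
    (hcov : P.IsConformallyCovariant) (hP : P.IsChordal)
    {ι : Type*} {l : Filter ι} [l.IsCountablyGenerated]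
    {B D' : DobrushinDomain} {E : ι → DobrushinDomain} {Φ : C(ℂ, ℂ)} {Φs : ι → C(ℂ, ℂ)}
    (hΦd : DifferentiableOn ℂ Φ B.carrier) (hΦi : InjOn Φ B.carrier)
    (hD' : D'.carrier = Φ '' B.carrier) (h0 : D'.pt 0 = Φ (B.pt 0)) (h1 : D'.pt 1 = Φ (B.pt 1))
    (hE : ∀ᶠ i in l, DifferentiableOn ℂ (Φs i) B.carrier ∧ InjOn (Φs i) B.carrier ∧
      (E i).carrier = Φs i '' B.carrier ∧ (E i).pt 0 = Φs i (B.pt 0) ∧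
      (E i).pt 1 = Φs i (B.pt 1))
    (hunif : TendstoUniformlyOn (fun i => ⇑(Φs i)) Φ l (closure B.carrier))
    (f : CurveClass ℂ →ᵇ ℝ) :
    Tendsto (fun i => ∫ γ, f γ ∂(P (E i))) l (𝓝 (∫ γ, f γ ∂(P D'))) :=
  hcov.tendsto_integral_of_tendstoUniformlyOn (fun D => by haveI := (hP D).1; infer_instance)
    (fun D => ((hP D).2.mono fun _ h => h.2.2)) hΦd hΦi hD' h0 h1 hE hunif f

end ChordalFamily

/-! ### The unit disc marked at `-1, 1`, and closed-disc uniformizers -/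

/-- **A Dobrushin structure on the unit disc marked at `-1` and `1` exists** (the image of
`DobrushinDomain.unitDisc`, marked at `1, -1`, under the rotation `z ↦ -z`). [folklore] -/
theorem DobrushinDomain.exists_carrier_eq_ball_pt_eq :
    ∃ B : DobrushinDomain, B.carrier = Metric.ball (0 : ℂ) 1 ∧ B.pt 0 = -1 ∧ B.pt 1 = 1 := by
  refine ⟨DobrushinDomain.unitDisc.map (similarity (-1) (by norm_num) 0), ?_, ?_, ?_⟩
  · rw [MarkedDomain.carrier_map]
    ext z
    change z ∈ (similarity (-1) _ 0) '' Metric.ball (0 : ℂ) 1 ↔ _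
    simp only [mem_image, Metric.mem_ball, dist_zero_right, similarity_apply, neg_mul, one_mul,
      add_zero]
    constructor
    · rintro ⟨w, hw, rfl⟩
      rwa [norm_neg]
    · intro hz
      exact ⟨-z, by rwa [norm_neg], neg_neg z⟩
  · rw [MarkedDomain.pt_map, similarity_apply]
    have : DobrushinDomain.unitDisc.pt 0 = 1 := by
      change circleMap 0 1 (2 * π * ((![0, 1 / 2] : Fin 2 → ℝ) 0)) = 1
      simp [circleMap]
    rw [this]
    norm_num
  · rw [MarkedDomain.pt_map, similarity_apply]
    have : DobrushinDomain.unitDisc.pt 1 = -1 := by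
      change circleMap 0 1 (2 * π * ((![0, 1 / 2] : Fin 2 → ℝ) 1)) = -1
      have h : 2 * π * ((![0, 1 / 2] : Fin 2 → ℝ) 1) = π := by simp; ring
      rw [h, circleMap, zero_add]
      push_cast
      rw [one_mul, Complex.exp_pi_mul_I]
    rw [this]
    norm_num

namespace ChordalFamily

variable {P : ChordalFamily}

/-- A conformal equivalence from the unit disc, extended continuously, supplies the data of
`IsConformallyCovariant.eq_map_of_image` over any unit-disc parameter domain. [folklore] -/
theorem image_data_of_conformalEquiv_ball {B E : DobrushinDomain}
    (hB : B.carrier = Metric.ball (0 : ℂ) 1) (hB0 : B.pt 0 = -1) (hB1 : B.pt 1 = 1)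
    {Ψ : C(ℂ, ℂ)} (g : ConformalEquiv (Metric.ball (0 : ℂ) 1) E.carrier)
    (hΨ : EqOn Ψ g (Metric.ball (0 : ℂ) 1)) (hE0 : E.pt 0 = Ψ (-1)) (hE1 : E.pt 1 = Ψ 1) :
    DifferentiableOn ℂ Ψ B.carrier ∧ InjOn Ψ B.carrier ∧ E.carrier = Ψ '' B.carrier ∧
      E.pt 0 = Ψ (B.pt 0) ∧ E.pt 1 = Ψ (B.pt 1) := by
  rw [hB, hB0, hB1]
  refine ⟨g.differentiableOn_coe.congr hΨ, ?_, ?_, hE0, hE1⟩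
  · intro z hz w hw hzw
    rw [hΨ hz, hΨ hw] at hzw
    exact g.injOn hz hw hzw
  · rw [hΨ.image_eq]
    exact g.bijOn.image_eq.symm

/-- **Weak continuity along closed-disc uniformizers converging uniformly on the closed disc**
(the `RadoSqueezeFamily` shape of the summit routes): if `P` is chordal and conformally
covariant, `E t` (`t > 0`) and `D'` are Dobrushin domains with continuous `Φ_t, Φ : ℂ → ℂ`
which are conformal equivalences from the open unit disc onto `E t`, `D'` respectively, sending
`-1, 1` to the marked points, and `Φ_t → Φ` uniformly on the closed unit disc as `t → 0⁺`, then
`∫ f dP(E t) → ∫ f dP(D')` as `t → 0⁺` for every bounded continuous `f`. [folklore] -/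
theorem IsConformallyCovariant.tendsto_integral_of_discUniformizers
    (hcov : P.IsConformallyCovariant) (hP : P.IsChordal)
    {D' : DobrushinDomain} {E : ℝ → DobrushinDomain} {Φ : C(ℂ, ℂ)} {Φt : ℝ → C(ℂ, ℂ)}
    (hΦt : ∀ t : ℝ, 0 < t → ∃ g : ConformalEquiv (Metric.ball (0 : ℂ) 1) (E t).carrier,
      EqOn (Φt t) g (Metric.ball (0 : ℂ) 1))
    (hΦ : ∃ g : ConformalEquiv (Metric.ball (0 : ℂ) 1) D'.carrier, EqOn Φ g (Metric.ball (0 : ℂ) 1))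
    (hEpt : ∀ t : ℝ, 0 < t → (E t).pt 0 = Φt t (-1) ∧ (E t).pt 1 = Φt t 1)
    (hD'0 : D'.pt 0 = Φ (-1)) (hD'1 : D'.pt 1 = Φ 1)
    (hunif : TendstoUniformlyOn (fun t => ((Φt t : C(ℂ, ℂ)) : ℂ → ℂ)) (Φ : ℂ → ℂ) (𝓝[>] (0 : ℝ))
      (Metric.closedBall (0 : ℂ) 1))
    (f : CurveClass ℂ →ᵇ ℝ) :
    Tendsto (fun t : ℝ => ∫ γ, f γ ∂(P (E t))) (𝓝[>] (0 : ℝ)) (𝓝 (∫ γ, f γ ∂(P D'))) := by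
  obtain ⟨B, hB, hB0, hB1⟩ := DobrushinDomain.exists_carrier_eq_ball_pt_eq
  obtain ⟨g, hg⟩ := hΦ
  obtain ⟨hd, hi, hc, h0, h1⟩ := image_data_of_conformalEquiv_ball hB hB0 hB1 g hg hD'0 hD'1
  have hEdata : ∀ᶠ t in 𝓝[>] (0 : ℝ), DifferentiableOn ℂ (Φt t) B.carrier ∧
      InjOn (Φt t) B.carrier ∧ (E t).carrier = Φt t '' B.carrier ∧
      (E t).pt 0 = Φt t (B.pt 0) ∧ (E t).pt 1 = Φt t (B.pt 1) := by
    filter_upwards [self_mem_nhdsWithin] with t ht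
    obtain ⟨gt, hgt⟩ := hΦt t ht
    exact image_data_of_conformalEquiv_ball hB hB0 hB1 gt hgt (hEpt t ht).1 (hEpt t ht).2
  have hunif' : TendstoUniformlyOn (fun t => ⇑(Φt t)) Φ (𝓝[>] (0 : ℝ)) (closure B.carrier) := by
    rw [hB, closure_ball (0 : ℂ) one_ne_zero]
    exact hunif
  exact hcov.tendsto_integral_of_tendstoUniformlyOn_of_isChordal hP hd hi hc h0 h1 hEdata hunif' f

end ChordalFamily

end Literature.Probability.RandomPlanarGeometry

end
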